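import Summits.CriticalPhenomena.PercolationContinuityZ3.Theorems.Transplant.NilpotentCommutatorFinite
import Mathlib.GroupTheory.Abelianization.Defs
import Mathlib.Tactic.LinearCombination
import HarnessLib

/-!
# A nilpotent group with two independent characters contains `ℤ²` (pure group theory; kernel)

builds on p205010 (kernel theorem, internal audit signed; external expert review pending) — nothing in this file uses p205010.  Pure group theory.
Lane `prim-bschramm`, seat `prim-bschramm-p4` gen 22 (PART C3 of `P4-GENERAL.md` §44).  Helper file (`--supports stmt-CriticalPhenomena-4575 --as helper`).

THE LEMMA (**`NilPair.exists_commuting_independent_pair`**).  Let `G` be nilpotent (`γ_{c+1}(G) = 1`) with characters `ψ₀, ψ₁ : G → ℤ` and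
elements `a, b` with `ψ₀(a)ψ₁(b) ≠ ψ₁(a)ψ₀(b)` (`b₁(G) ≥ 2`).  Then `G` contains two COMMUTING elements `x, y` with
`x^m y^n = 1 ⟹ m = n = 0` — an embedded `ℤ²`.  (Finite generation is not needed.)  With gen 22's `CayleyZSq.criticalProb_lt_one` this is
the passage from "`b₁ ≥ 2` on a finite-index nilpotent subgroup" to "`p_c < 1` for EVERY generating set of the whole group" that the virtually
nilpotent rows of the C3 class map need (sequel file `CayleyVirtuallyNilpotentDichotomy`): Lyons–Peres' Thm. 7.18 ("polynomial growth ⟹ almost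
`ℤ` or contains `ℤ²`") with Gromov's theorem replaced by the hypothesis "virtually nilpotent".
PROOF (kernel; no finiteness anywhere).  TORSION DEPTH (`exists_torsionDepth`): either every element of `[G,G] = γ₂` has finite order, or there
is a largest `k ≥ 1` with an element `z ∈ γ_{k+1}`… precisely some `k` with an infinite-order `z ∈ L k` (`L k = γ_{k+1}`) and `L (k+1)` torsion.
DESCENT (`exists_pow_commute`): if `L (k+1)` is torsion and `y ∈ L k`, then some power `y^E` (`E ≥ 1`) commutes with any given `x` — because
`f = ⁅y, x⁆ ∈ L j` has finite order `e` and `⁅y^e, x⁆ ≡ f^e = 1 (mod L (j+1))` (`mk_commutator_pow_left_of_mem`, the left power law one level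
down, from `⁅y y', x⁆ = y⁅y', x⁆y⁻¹ ⁅y, x⁆`), so the commutator descends one step per power until it reaches `L c = 1`.  PAIR: in the torsion
case take `(a, b^E)` (independence from the `2 × 2` determinant); otherwise `(a, z^E)` with `ψ(a) ≠ 0` for one of the characters
(independence: characters kill `[G,G] ∋ z`, and `z` has infinite order).
[cite: LyonsPeres2016, §7.4 Thm. 7.18 and §7.9 (proof: upper central series of torsion-free nilpotent groups)] [cite: MilnorSolvableGrowth1968, Lemma 1]
-/

namespace Summit.CriticalPhenomena.PercolationContinuityZ3.Theorems.Transplant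

open scoped commutatorElement

namespace NilPair

variable {G : Type*} [Group G]

/-! ## §1 The left power law one level down -/

/-- Conjugation fixes `L j` modulo `L (j+1)`. [folklore] -/
theorem mk_conj_of_mem {j : ℕ} {g : G} (hg : g ∈ (⊤ : Subgroup G).lowerCentralSeries j) (y : G) :
    (QuotientGroup.mk (y * g * y⁻¹) : G ⧸ (⊤ : Subgroup G).lowerCentralSeries (j + 1)) = QuotientGroup.mk g := by
  rw [QuotientGroup.eq]
  have h := NilBetti.commutator_mem_L_succ' y (inv_mem hg : g⁻¹ ∈ (⊤ : Subgroup G).lowerCentralSeries j)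
  rw [commutatorElement_def, inv_inv] at h
  have e : (y * g * y⁻¹)⁻¹ * g = y * g⁻¹ * y⁻¹ * g := by group
  rwa [e]

/-- **Left power law one level down**: if `⁅y, x⁆ ∈ L j` then `⁅y ^ e, x⁆ ≡ ⁅y, x⁆ ^ e (mod L (j+1))` — for ANY `y` (not necessarily in `L (j-1)`).
[folklore] -/
theorem mk_commutator_pow_left_of_mem {j : ℕ} {y x : G} (hf : ⁅y, x⁆ ∈ (⊤ : Subgroup G).lowerCentralSeries j) :
    ∀ e : ℕ, (QuotientGroup.mk ⁅y ^ e, x⁆ : G ⧸ (⊤ : Subgroup G).lowerCentralSeries (j + 1)) = (QuotientGroup.mk ⁅y, x⁆) ^ e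
  | 0 => by rw [pow_zero, pow_zero, commutatorElement_one_left, QuotientGroup.mk_one]
  | e + 1 => by
    have hid : ⁅y ^ (e + 1), x⁆ = (y ^ e * ⁅y, x⁆ * (y ^ e)⁻¹) * ⁅y ^ e, x⁆ := by
      simp only [commutatorElement_def, pow_succ]; group
    rw [hid, QuotientGroup.mk_mul, mk_conj_of_mem hf, mk_commutator_pow_left_of_mem hf e, pow_succ']

/-- If `⁅y, x⁆ ∈ L j` has finite order `e` then `⁅y ^ e, x⁆ ∈ L (j+1)`. [folklore] -/
theorem commutator_pow_mem_succ {j : ℕ} {y x : G} (hf : ⁅y, x⁆ ∈ (⊤ : Subgroup G).lowerCentralSeries j) {e : ℕ} (he : ⁅y, x⁆ ^ e = 1) :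
    ⁅y ^ e, x⁆ ∈ (⊤ : Subgroup G).lowerCentralSeries (j + 1) := by
  rw [← QuotientGroup.eq_one_iff, mk_commutator_pow_left_of_mem hf e, ← QuotientGroup.mk_pow, he, QuotientGroup.mk_one]

/-! ## §2 Descent: below a torsion level, a power of `y` commutes with `x` -/

/-- **Descent**: `L c = 1`, every element of `L (k+1)` of finite order; if `⁅y, x⁆ ∈ L j` with `k + 1 ≤ j` then some `y ^ E` (`E ≥ 1`) commutes
with `x` (induction on `c - j`: the commutator has finite order `e`, and `⁅y^e, x⁆` lies one level deeper). [folklore] -/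
theorem exists_pow_commute_aux {c : ℕ} (hnil : (⊤ : Subgroup G).lowerCentralSeries c = ⊥) {k : ℕ}
    (htor : ∀ g ∈ (⊤ : Subgroup G).lowerCentralSeries (k + 1), IsOfFinOrder g) (x : G) :
    ∀ (t j : ℕ) (y : G), j + t = c → k + 1 ≤ j → ⁅y, x⁆ ∈ (⊤ : Subgroup G).lowerCentralSeries j → ∃ E : ℕ, 0 < E ∧ Commute (y ^ E) x
  | 0, j, y, hj, _, hf => by
    refine ⟨1, Nat.one_pos, ?_⟩
    rw [pow_one, ← commutatorElement_eq_one_iff_commute]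
    have hj' : j = c := by omega
    rw [hj', hnil] at hf
    exact (Subgroup.mem_bot).1 hf
  | t + 1, j, y, hj, hkj, hf => by
    have hfin : IsOfFinOrder ⁅y, x⁆ := htor _ (Subgroup.lowerCentralSeries_antitone ⊤ hkj hf)
    obtain ⟨e, he, hpow⟩ := hfin.exists_pow_eq_one
    have hf' : ⁅y ^ e, x⁆ ∈ (⊤ : Subgroup G).lowerCentralSeries (j + 1) := commutator_pow_mem_succ hf hpow
    obtain ⟨E', hE', hcomm⟩ := exists_pow_commute_aux hnil htor x t (j + 1) (y ^ e) (by omega) (by omega) hf'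
    exact ⟨e * E', Nat.mul_pos he hE', by rw [pow_mul]; exact hcomm⟩

/-- **Descent, packaged**: if `L c = 1`, `L (k+1)` is torsion and `y ∈ L k`, then for every `x` some power `y ^ E`, `E ≥ 1`, commutes with `x`.
[folklore] -/
theorem exists_pow_commute {c : ℕ} (hnil : (⊤ : Subgroup G).lowerCentralSeries c = ⊥) {k : ℕ}
    (htor : ∀ g ∈ (⊤ : Subgroup G).lowerCentralSeries (k + 1), IsOfFinOrder g) {y : G} (hy : y ∈ (⊤ : Subgroup G).lowerCentralSeries k)
    (x : G) : ∃ E : ℕ, 0 < E ∧ Commute (y ^ E) x := by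
  have hf : ⁅y, x⁆ ∈ (⊤ : Subgroup G).lowerCentralSeries (k + 1) := NilBetti.commutator_mem_L_succ hy x
  by_cases hkc : k + 1 ≤ c
  · exact exists_pow_commute_aux hnil htor x (c - (k + 1)) (k + 1) y (by omega) le_rfl hf
  · refine ⟨1, Nat.one_pos, ?_⟩
    rw [pow_one, ← commutatorElement_eq_one_iff_commute]
    have hle : (⊤ : Subgroup G).lowerCentralSeries (k + 1) ≤ (⊤ : Subgroup G).lowerCentralSeries c :=
      Subgroup.lowerCentralSeries_antitone ⊤ (by omega)
    have h := hle hf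
    rw [hnil] at h
    exact (Subgroup.mem_bot).1 h

/-! ## §3 The torsion depth -/

/-- **Torsion depth**: in a nilpotent group, from any level `m` on either every element of `L m` has finite order, or there is a level `k ≥ m` carrying
an element of infinite order with `L (k+1)` torsion. [folklore] -/
theorem exists_torsionDepth {c : ℕ} (hnil : (⊤ : Subgroup G).lowerCentralSeries c = ⊥) :
    ∀ (d m : ℕ), m + d = c → (∀ g ∈ (⊤ : Subgroup G).lowerCentralSeries m, IsOfFinOrder g) ∨
      ∃ k, m ≤ k ∧ (∃ z ∈ (⊤ : Subgroup G).lowerCentralSeries k, ¬ IsOfFinOrder z) ∧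
        ∀ g ∈ (⊤ : Subgroup G).lowerCentralSeries (k + 1), IsOfFinOrder g
  | 0, m, hm => by
    left
    intro g hg
    have hm' : m = c := by omega
    rw [hm', hnil] at hg
    rw [(Subgroup.mem_bot).1 hg]
    exact IsOfFinOrder.one
  | d + 1, m, hm => by
    by_cases h : ∀ g ∈ (⊤ : Subgroup G).lowerCentralSeries m, IsOfFinOrder g
    · exact Or.inl h
    · right
      push Not at h
      obtain ⟨z, hz, hzinf⟩ := h
      rcases exists_torsionDepth hnil d (m + 1) (by omega) with htor | ⟨k, hk, hz', htor'⟩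
      · exact ⟨m, le_rfl, ⟨z, hz, hzinf⟩, htor⟩
      · exact ⟨k, by omega, hz', htor'⟩

/-! ## §4 The embedded `ℤ²` -/

/-- Characters kill the lower central series from `L 1 = [G, G]` on. [folklore] -/
theorem toAdd_char_eq_zero_of_mem {k : ℕ} (hk : 1 ≤ k) (ψ : G →* Multiplicative ℤ) {z : G}
    (hz : z ∈ (⊤ : Subgroup G).lowerCentralSeries k) : Multiplicative.toAdd (ψ z) = 0 := by
  have h1 : z ∈ commutator G := by
    rw [← Subgroup.top_lowerCentralSeries_one]; exact Subgroup.lowerCentralSeries_antitone ⊤ hk hz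
  have h2 := Abelianization.commutator_subset_ker ψ h1
  rw [MonoidHom.mem_ker] at h2
  rw [h2, toAdd_one]

/-- The `2 × 2` elimination: from `m u₀ + n v₀ = 0`, `m u₁ + n v₁ = 0` and `u₀ v₁ ≠ u₁ v₀`: `m = 0` and `n = 0`. [folklore] -/
theorem eq_zero_of_det_ne_zero {u₀ u₁ v₀ v₁ m n : ℤ} (hdet : u₀ * v₁ ≠ u₁ * v₀) (h0 : m * u₀ + n * v₀ = 0) (h1 : m * u₁ + n * v₁ = 0) :
    m = 0 ∧ n = 0 := by
  have hm : m * (u₀ * v₁ - u₁ * v₀) = 0 := by linear_combination v₁ * h0 - v₀ * h1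
  have hn : n * (u₀ * v₁ - u₁ * v₀) = 0 := by linear_combination u₀ * h1 - u₁ * h0
  have hd : u₀ * v₁ - u₁ * v₀ ≠ 0 := sub_ne_zero.2 hdet
  exact ⟨(mul_eq_zero.1 hm).resolve_right hd, (mul_eq_zero.1 hn).resolve_right hd⟩

/-- Applying a character to `x ^ m * y ^ n = 1`. [folklore] -/
theorem char_rel (ψ : G →* Multiplicative ℤ) {x y : G} {m n : ℤ} (h : x ^ m * y ^ n = 1) :
    m * Multiplicative.toAdd (ψ x) + n * Multiplicative.toAdd (ψ y) = 0 := by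
  have := congrArg (fun g => Multiplicative.toAdd (ψ g)) h
  simpa only [map_mul, map_zpow, map_one, toAdd_mul, toAdd_zpow, toAdd_one, smul_eq_mul] using this

/-- **THEOREM (pure group theory, kernel): a nilpotent group with two independent characters contains `ℤ²`.**  If `γ_{c+1}(G) = 1` and
`ψ₀(a)ψ₁(b) ≠ ψ₁(a)ψ₀(b)` for characters `ψ₀, ψ₁ : G → ℤ`, then there are COMMUTING `x, y ∈ G` with `x ^ m * y ^ n = 1 ⟹ m = n = 0`.
[cite: LyonsPeres2016, §7.4 Thm. 7.18 and §7.9] [cite: MilnorSolvableGrowth1968, Lemma 1] -/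
theorem exists_commuting_independent_pair {c : ℕ} (hnil : (⊤ : Subgroup G).lowerCentralSeries c = ⊥) (ψ₀ ψ₁ : G →* Multiplicative ℤ) (a b : G)
    (hind : Multiplicative.toAdd (ψ₀ a) * Multiplicative.toAdd (ψ₁ b) ≠ Multiplicative.toAdd (ψ₁ a) * Multiplicative.toAdd (ψ₀ b)) :
    ∃ x y : G, Commute x y ∧ ∀ m n : ℤ, x ^ m * y ^ n = 1 → m = 0 ∧ n = 0 := by
  rcases exists_torsionDepth hnil c 0 (by omega) with htor | ⟨k, -, ⟨z, hz, hzinf⟩, htor⟩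
  · -- every element of `G = L 0` has finite order: impossible, `a` has a non-zero character value... unless both vanish; use the determinant
    exfalso
    have ha : IsOfFinOrder a := htor a (Subgroup.mem_top a)
    have hb : IsOfFinOrder b := htor b (Subgroup.mem_top b)
    obtain ⟨m, hm, hma⟩ := ha.exists_pow_eq_one
    obtain ⟨n, hn, hnb⟩ := hb.exists_pow_eq_one
    have e0 := char_rel ψ₀ (x := a) (y := b) (m := m) (n := 0) (by rw [zpow_zero, mul_one, zpow_natCast, hma])
    have e1 := char_rel ψ₁ (x := a) (y := b) (m := m) (n := 0) (by rw [zpow_zero, mul_one, zpow_natCast, hma])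
    have := (eq_zero_of_det_ne_zero hind e0 e1).1
    omega
  · rcases Nat.eq_zero_or_pos k with rfl | hk
    · -- `k = 0`: `L 1 = [G,G]` is torsion; the pair is `(a, b^E)`
      obtain ⟨E, hE, hcomm⟩ := exists_pow_commute hnil htor (Subgroup.mem_top b) a
      refine ⟨a, b ^ E, hcomm.symm, fun m n h => ?_⟩
      rw [← zpow_natCast, ← zpow_mul] at h
      have e0 := char_rel ψ₀ h
      have e1 := char_rel ψ₁ h
      obtain ⟨hm, hn⟩ := eq_zero_of_det_ne_zero hind e0 e1
      refine ⟨hm, ?_⟩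
      rcases mul_eq_zero.1 hn with h1 | h1
      · exact absurd h1 (by exact_mod_cast hE.ne')
      · exact h1
    · -- `k ≥ 1`: `z ∈ L k ⊆ [G,G]` of infinite order, `L (k+1)` torsion; the pair is `(a', z^E)` with `ψ(a') ≠ 0`
      -- one of `a`, `b` has a non-zero `ψ₀`- or `ψ₁`-value; choose it
      have hex : ∃ (x : G) (ψ : G →* Multiplicative ℤ), Multiplicative.toAdd (ψ x) ≠ 0 := by
        by_contra hno
        push Not at hno
        exact hind (by rw [hno a ψ₀, hno a ψ₁, zero_mul, zero_mul])
      obtain ⟨x, ψ, hx⟩ := hex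
      obtain ⟨E, hE, hcomm⟩ := exists_pow_commute hnil htor hz x
      refine ⟨x, z ^ E, hcomm.symm, fun m n h => ?_⟩
      rw [← zpow_natCast, ← zpow_mul] at h
      have e0 := char_rel ψ h
      rw [toAdd_char_eq_zero_of_mem hk ψ hz, mul_zero, add_zero] at e0
      have hm : m = 0 := (mul_eq_zero.1 e0).resolve_right hx
      refine ⟨hm, ?_⟩
      rw [hm, zpow_zero, one_mul] at h
      -- `z ^ (E * n) = 1` with `z` of infinite order
      by_contra hn
      exact hzinf (isOfFinOrder_iff_zpow_eq_one.2 ⟨(E : ℤ) * n, mul_ne_zero (by exact_mod_cast hE.ne') hn, h⟩)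

end NilPair

end Summit.CriticalPhenomena.PercolationContinuityZ3.Theorems.Transplant
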